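import Summits.CriticalPhenomena.PercolationContinuityZ3.Theorems.PercNearOneGluingNoHeavyLowerTailCILReduction
import Summits.CriticalPhenomena.PercolationContinuityZ3.Theorems.PercNearOneGluingNoHeavyLowerTailMergeStability
import HarnessLib

/-!
# `NoHeavyLowerTail` (stmt-CriticalPhenomena-4575) — the PATTERN-LIGHTEST bounds (PL / PL-block) imply the
# cumulative isolation lemma, hence the crux

Support file (prover `prim-hp-8`, technique "tie/glue-locus exclusion"; `--supports stmt-CriticalPhenomena-4575`).
No definitions, no named facts, no sorries.

The cumulative isolation lemma `stub_cumulativeIsolation` (`∃ a ∈ A, μ(1 ≤ N ≤ j) ≤ μ(|π(a)| ≤ j)`) is proved for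
`|A| ≤ 4`, at level `1`, and for many observer classes; its open rung (the hull-port residual) is a CHAMPION
inequality whose only delicate configurations are the champion TIES (`…TieLocus`).  The hypotheses of this file are
two census-clean (0 violations / ≈ 6·10⁴ exact cases + adversarial climbs, k ≤ 6, n ≤ 9, all levels; ttrl request
`pl-pattern-lightest`) HYPOTHESIS-FREE strengthenings in which the witness is chosen PER ATTACHMENT PATTERN, so that
there is no champion and no tie locus at all (their equality locus is the glue locus):

* **PL-block** (`hBL`): with `π(o) = {x ∈ A : o ↔ x}` the relay block of the observer,
  `μ(1 ≤ N ≤ j) ≤ Σ_{∅ ≠ B ⊆ A} μ(π(o) = B) · μ(|π(sel B)| ≤ j)` for SOME selection `sel B ∈ B` (equivalently for the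
  selection of the most light-prone member of `B`): "the observer's block is small and nonempty no more often than
  the expected lightness of the best relay it contains".
* **PL** (`hPL`): the same with the finer pattern `π⁰(o) = {b ∈ A : o ↔ b inside (V ∖ A) ∪ {b}}` of the relays
  attached to `o` DIRECTLY (through relay-free open paths); PL ⇒ PL-block ⇒ CIL.

Both imply `stub_cumulativeIsolation` in one line (`Σ_B μ(π(o) = B) ≤ 1` and `μ(|π(sel B)| ≤ j) ≤ max_a μ(|π(a)| ≤ j)`):
`cumulativeIsolation_of_blockLightest`, `cumulativeIsolation_of_patternLightest`, and hence the crux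
(`noHeavyLowerTail_of_blockLightest`, `noHeavyLowerTail_of_patternLightest`).
-/

noncomputable section

namespace Summit.CriticalPhenomena.PercolationContinuityZ3.Theorems

namespace PatternLightest

open MeasureTheory Set Literature.Probability.LatticeModels Literature.Probability.Percolation
open scoped Classical BigOperators

variable {n : ℕ}

/-- The fibres of any map on configurations over a finite set of values have total probability at most `1`.
[folklore] -/
theorem sum_real_fiber_le_one (μ : Measure (BondConfig (Fin n))) [IsProbabilityMeasure μ]
    {β : Type*} (f : BondConfig (Fin n) → β) (s : Finset β) :
    ∑ B ∈ s, μ.real {ω : BondConfig (Fin n) | f ω = B} ≤ 1 := by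
  have h : ∑ B ∈ s, μ.real (f ⁻¹' {B}) = μ.real (f ⁻¹' (↑s : Set β)) :=
    sum_measureReal_preimage_singleton s (fun B _ => (Set.toFinite _).measurableSet)
  have h' : ∀ B, ({ω : BondConfig (Fin n) | f ω = B} : Set (BondConfig (Fin n))) = f ⁻¹' {B} := by
    intro B; ext ω; simp
  simp only [h'] 
  rw [h]
  exact (measureReal_mono (Set.subset_univ _) (measure_ne_top _ _)).trans (le_of_eq probReal_univ)

/-- **A pattern bound with a per-pattern witness implies the cumulative isolation lemma.**  If
`μ(L) ≤ Σ_{B ∈ s} μ(pat = B) · μ(R_{sel B})` for a pattern map `pat`, a finite family `s` of patterns and a selection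
`sel` with `sel B ∈ A` for `B ∈ s`, then `μ(L) ≤ max_a μ(R_a)` (attained at a champion). [folklore] -/
theorem le_champion_of_patternBound (μ : Measure (BondConfig (Fin n))) [IsProbabilityMeasure μ]
    (A : Finset (Fin n)) (j : ℕ) {β : Type*} (pat : BondConfig (Fin n) → β) (s : Finset β) (sel : β → Fin n)
    (hsel : ∀ B ∈ s, sel B ∈ A) (L : Set (BondConfig (Fin n))) (q : Fin n)
    (hq : ∀ a ∈ A, μ.real {ω : BondConfig (Fin n) | (A.filter fun x => ω ∈ openConn a x).card ≤ j} ≤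
      μ.real {ω : BondConfig (Fin n) | (A.filter fun x => ω ∈ openConn q x).card ≤ j})
    (hL : μ.real L ≤ ∑ B ∈ s, μ.real {ω : BondConfig (Fin n) | pat ω = B} *
      μ.real {ω : BondConfig (Fin n) | (A.filter fun x => ω ∈ openConn (sel B) x).card ≤ j}) :
    μ.real L ≤ μ.real {ω : BondConfig (Fin n) | (A.filter fun x => ω ∈ openConn q x).card ≤ j} := by
  refine hL.trans ?_
  calc ∑ B ∈ s, μ.real {ω : BondConfig (Fin n) | pat ω = B} *
        μ.real {ω : BondConfig (Fin n) | (A.filter fun x => ω ∈ openConn (sel B) x).card ≤ j}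
      ≤ ∑ B ∈ s, μ.real {ω : BondConfig (Fin n) | pat ω = B} *
        μ.real {ω : BondConfig (Fin n) | (A.filter fun x => ω ∈ openConn q x).card ≤ j} := by
          apply Finset.sum_le_sum
          intro B hB
          exact mul_le_mul_of_nonneg_left (hq (sel B) (hsel B hB)) measureReal_nonneg
    _ = (∑ B ∈ s, μ.real {ω : BondConfig (Fin n) | pat ω = B}) *
        μ.real {ω : BondConfig (Fin n) | (A.filter fun x => ω ∈ openConn q x).card ≤ j} := by
          rw [Finset.sum_mul]
    _ ≤ 1 * μ.real {ω : BondConfig (Fin n) | (A.filter fun x => ω ∈ openConn q x).card ≤ j} :=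
          mul_le_mul_of_nonneg_right (sum_real_fiber_le_one μ pat s) measureReal_nonneg
    _ = _ := one_mul _

/-- **PL-block ⇒ the cumulative isolation lemma.**  Hypothesis `hBL`: for every weighted graph, relay set `A`,
observer `o ∉ A` and level `j` there is a selection `sel` (`sel B ∈ B` for nonempty `B ⊆ A`) with
`μ(1 ≤ N ≤ j) ≤ Σ_{∅ ≠ B ⊆ A} μ(π(o) = B)·μ(|π(sel B)| ≤ j)`, `π(v) = A.filter (v ↔ ·)`.  Conclusion = the registered
stub `stub_cumulativeIsolation` verbatim (witness: any champion). -/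
theorem cumulativeIsolation_of_blockLightest
    (hBL : ∀ (n : ℕ) (w : Sym2 (Fin n) → unitInterval) (A : Finset (Fin n)) (o : Fin n) (j : ℕ), o ∉ A →
      ∃ sel : Finset (Fin n) → Fin n, (∀ B ∈ A.powerset.erase ∅, sel B ∈ B) ∧
        (Literature.Probability.LatticeModels.prodBernoulli w).real
            {ω : Literature.Probability.Percolation.BondConfig (Fin n) |
              1 ≤ (A.filter fun x => ω ∈ Literature.Probability.Percolation.openConn o x).card ∧
                (A.filter fun x => ω ∈ Literature.Probability.Percolation.openConn o x).card ≤ j} ≤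
          ∑ B ∈ A.powerset.erase ∅,
            (Literature.Probability.LatticeModels.prodBernoulli w).real
                {ω : Literature.Probability.Percolation.BondConfig (Fin n) |
                  (A.filter fun x => ω ∈ Literature.Probability.Percolation.openConn o x) = B} *
              (Literature.Probability.LatticeModels.prodBernoulli w).real
                {ω : Literature.Probability.Percolation.BondConfig (Fin n) |
                  (A.filter fun x => ω ∈ Literature.Probability.Percolation.openConn (sel B) x).card ≤ j}) :
    ∀ (n : ℕ) (w : Sym2 (Fin n) → unitInterval) (A : Finset (Fin n)) (o : Fin n) (j : ℕ),
      A.Nonempty → o ∉ A → ∃ a ∈ A,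
        (Literature.Probability.LatticeModels.prodBernoulli w).real
            {ω : Literature.Probability.Percolation.BondConfig (Fin n) |
              1 ≤ (A.filter fun x => ω ∈ Literature.Probability.Percolation.openConn o x).card ∧
                (A.filter fun x => ω ∈ Literature.Probability.Percolation.openConn o x).card ≤ j} ≤
          (Literature.Probability.LatticeModels.prodBernoulli w).real
            {ω : Literature.Probability.Percolation.BondConfig (Fin n) |
              (A.filter fun x => ω ∈ Literature.Probability.Percolation.openConn a x).card ≤ j} := by
  intro n w A o j hA ho
  obtain ⟨q, hq, hchamp⟩ := MergeStability.exists_champion (prodBernoulli w) A hA j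
  obtain ⟨sel, hsel, hL⟩ := hBL n w A o j ho
  refine ⟨q, hq, le_champion_of_patternBound (prodBernoulli w) A j
    (fun ω => A.filter fun x => ω ∈ openConn o x) (A.powerset.erase ∅) sel ?_ _ q hchamp hL⟩
  intro B hB
  have hBA : B ⊆ A := Finset.mem_powerset.1 (Finset.mem_of_mem_erase hB)
  exact hBA (hsel B hB)

/-- **PL ⇒ the cumulative isolation lemma.**  Hypothesis `hPL`: as `hBL` but with the finer pattern `π⁰(o)` of the
relays attached to `o` DIRECTLY, `π⁰(o) = A.filter (fun b => o ↔ b inside (↑A)ᶜ ∪ {b})` (open paths whose interior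
avoids `A`).  Conclusion = `stub_cumulativeIsolation` verbatim. -/
theorem cumulativeIsolation_of_patternLightest
    (hPL : ∀ (n : ℕ) (w : Sym2 (Fin n) → unitInterval) (A : Finset (Fin n)) (o : Fin n) (j : ℕ), o ∉ A →
      ∃ sel : Finset (Fin n) → Fin n, (∀ B ∈ A.powerset.erase ∅, sel B ∈ B) ∧
        (Literature.Probability.LatticeModels.prodBernoulli w).real
            {ω : Literature.Probability.Percolation.BondConfig (Fin n) |
              1 ≤ (A.filter fun x => ω ∈ Literature.Probability.Percolation.openConn o x).card ∧
                (A.filter fun x => ω ∈ Literature.Probability.Percolation.openConn o x).card ≤ j} ≤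
          ∑ B ∈ A.powerset.erase ∅,
            (Literature.Probability.LatticeModels.prodBernoulli w).real
                {ω : Literature.Probability.Percolation.BondConfig (Fin n) |
                  (A.filter fun b => ω ∈ Literature.Probability.Percolation.openConnIn
                      ((↑A : Set (Fin n))ᶜ ∪ {b}) o b) = B} *
              (Literature.Probability.LatticeModels.prodBernoulli w).real
                {ω : Literature.Probability.Percolation.BondConfig (Fin n) |
                  (A.filter fun x => ω ∈ Literature.Probability.Percolation.openConn (sel B) x).card ≤ j}) :
    ∀ (n : ℕ) (w : Sym2 (Fin n) → unitInterval) (A : Finset (Fin n)) (o : Fin n) (j : ℕ),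
      A.Nonempty → o ∉ A → ∃ a ∈ A,
        (Literature.Probability.LatticeModels.prodBernoulli w).real
            {ω : Literature.Probability.Percolation.BondConfig (Fin n) |
              1 ≤ (A.filter fun x => ω ∈ Literature.Probability.Percolation.openConn o x).card ∧
                (A.filter fun x => ω ∈ Literature.Probability.Percolation.openConn o x).card ≤ j} ≤
          (Literature.Probability.LatticeModels.prodBernoulli w).real
            {ω : Literature.Probability.Percolation.BondConfig (Fin n) |
              (A.filter fun x => ω ∈ Literature.Probability.Percolation.openConn a x).card ≤ j} := by
  intro n w A o j hA ho
  obtain ⟨q, hq, hchamp⟩ := MergeStability.exists_champion (prodBernoulli w) A hA j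
  obtain ⟨sel, hsel, hL⟩ := hPL n w A o j ho
  refine ⟨q, hq, le_champion_of_patternBound (prodBernoulli w) A j
    (fun ω => A.filter fun b => ω ∈ openConnIn ((↑A : Set (Fin n))ᶜ ∪ {b}) o b) (A.powerset.erase ∅) sel ?_ _ q
    hchamp hL⟩
  intro B hB
  have hBA : B ⊆ A := Finset.mem_powerset.1 (Finset.mem_of_mem_erase hB)
  exact hBA (hsel B hB)

/-- **PL-block closes the crux** (through `cumulativeIsolation_of_blockLightest` and the landed
`noHeavyLowerTail_of_stub_cumulativeIsolation`). -/
theorem noHeavyLowerTail_of_blockLightest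
    (hBL : ∀ (n : ℕ) (w : Sym2 (Fin n) → unitInterval) (A : Finset (Fin n)) (o : Fin n) (j : ℕ), o ∉ A →
      ∃ sel : Finset (Fin n) → Fin n, (∀ B ∈ A.powerset.erase ∅, sel B ∈ B) ∧
        (Literature.Probability.LatticeModels.prodBernoulli w).real
            {ω : Literature.Probability.Percolation.BondConfig (Fin n) |
              1 ≤ (A.filter fun x => ω ∈ Literature.Probability.Percolation.openConn o x).card ∧
                (A.filter fun x => ω ∈ Literature.Probability.Percolation.openConn o x).card ≤ j} ≤
          ∑ B ∈ A.powerset.erase ∅,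
            (Literature.Probability.LatticeModels.prodBernoulli w).real
                {ω : Literature.Probability.Percolation.BondConfig (Fin n) |
                  (A.filter fun x => ω ∈ Literature.Probability.Percolation.openConn o x) = B} *
              (Literature.Probability.LatticeModels.prodBernoulli w).real
                {ω : Literature.Probability.Percolation.BondConfig (Fin n) |
                  (A.filter fun x => ω ∈ Literature.Probability.Percolation.openConn (sel B) x).card ≤ j}) :
    Summit.CriticalPhenomena.PercolationContinuityZ3.Theses.PercNearOneGluing.NoHeavyLowerTail :=
  noHeavyLowerTail_of_stub_cumulativeIsolation (cumulativeIsolation_of_blockLightest hBL)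

/-- **PL closes the crux** (through `cumulativeIsolation_of_patternLightest`). -/
theorem noHeavyLowerTail_of_patternLightest
    (hPL : ∀ (n : ℕ) (w : Sym2 (Fin n) → unitInterval) (A : Finset (Fin n)) (o : Fin n) (j : ℕ), o ∉ A →
      ∃ sel : Finset (Fin n) → Fin n, (∀ B ∈ A.powerset.erase ∅, sel B ∈ B) ∧
        (Literature.Probability.LatticeModels.prodBernoulli w).real
            {ω : Literature.Probability.Percolation.BondConfig (Fin n) |
              1 ≤ (A.filter fun x => ω ∈ Literature.Probability.Percolation.openConn o x).card ∧
                (A.filter fun x => ω ∈ Literature.Probability.Percolation.openConn o x).card ≤ j} ≤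
          ∑ B ∈ A.powerset.erase ∅,
            (Literature.Probability.LatticeModels.prodBernoulli w).real
                {ω : Literature.Probability.Percolation.BondConfig (Fin n) |
                  (A.filter fun b => ω ∈ Literature.Probability.Percolation.openConnIn
                      ((↑A : Set (Fin n))ᶜ ∪ {b}) o b) = B} *
              (Literature.Probability.LatticeModels.prodBernoulli w).real
                {ω : Literature.Probability.Percolation.BondConfig (Fin n) |
                  (A.filter fun x => ω ∈ Literature.Probability.Percolation.openConn (sel B) x).card ≤ j}) :
    Summit.CriticalPhenomena.PercolationContinuityZ3.Theses.PercNearOneGluing.NoHeavyLowerTail :=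
  noHeavyLowerTail_of_stub_cumulativeIsolation (cumulativeIsolation_of_patternLightest hPL)

end PatternLightest

end Summit.CriticalPhenomena.PercolationContinuityZ3.Theorems

end
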